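import Mathlib
import HarnessLib

/-!
# The growth process of Grimmett–Manolescu: its maximal height grows at speed `< 1`

The probabilistic core of the transport of *horizontal* box crossings by track exchanges in
Grimmett–Manolescu's proof of the box-crossing property for isoradial graphs (PTRF 159 (2014)
273–327 = arXiv:1204.0505, §6.2, proof of the proposition on horizontal crossings; it is taken
over from their AoP 41 (2013) paper on inhomogeneous square/triangular/hexagonal lattices, §3.4).
When an open horizontal crossing `γ` is pushed through the regular block by the track exchanges
`U_1, …, U_{λN}`, its column heights `H^k_n` may grow; the growth is dominated by the **growth
process** `X^k = (X^k_n : n ∈ ℤ)`: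

* (a) `X^0_n = N` for `|n| ≤ ρN` and `X^0_n = N + ρN - |n|` otherwise;
* (b) `X^{k+1}_n = max{X^k_{n-1}, X^k_n + Y^k_n, X^k_{n+1}}`, with `(Y^k_n)` independent
  Bernoulli(`η`) variables, `η = η(ε) < 1`;

and the lemma proved here (GM14 §6.2, the lemma cited from [GM13]: "There exist `λ, N₀ ∈ ℕ`,
depending on `η` only, such that `P(max_n X^{λN}_n ≤ λN) ≥ 1 - ρ e^{-N}`, `ρ ∈ ℕ, N ≥ N₀`";
GM13 §3.4, Lemma `growth_process_domination`) says that the top of the process advances at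
speed strictly less than one. Together with the comparison `H^k ≤ X^k` (GM14 §6.2: "each range
`X^k` is regular and `X^{k+1} ≥ C(X^k) ≥ C(H^k)` […] `X^{k+1}_n ≥ X^k_n + 1 ≥ H^k_n + 1 = H^{k+1}_n`")
it yields `P(h(γ^{λN}) ≤ λN | ω^0) ≥ 1 - ρ e^{-N}`, the estimate that completes the proof of the
horizontal-crossing proposition. Everything in this file is geometry-free.

## Contents

* `GrowthProcess.step`, `GrowthProcess.process`, `GrowthProcess.initialRange` — the process
  (a)–(b) as a deterministic function of the field `Y : ℕ → ℤ → Bool` (`Y k n = true` iff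
  `Y^k_n = 1`).
* `GrowthProcess.exists_measure_exists_lt_process_le` — **the lemma**, upper-bound form
  `P(∃ n, X^{λN}_n > λN) ≤ ρ e^{-N}` (`ρ ≥ 1`, `N ≥ N₀ = 6`, `λ = λ(η)`), for *every* measure `P`
  and every family `Y` of Boolean random variables satisfying the **product bound**
  `P(Y_i = 1 ∀ i ∈ T) ≤ η^{|T|}` (`T ⊆ ℕ × ℤ` finite); `GrowthProcess.productBound_of_iIndepFun`
  derives the product bound from independence and `P(Y^k_n = 1) ≤ η`, so the printed hypothesis
  is covered, and so is any coupling in which the `Y^k_n` are only conditionally dominated.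
  `GrowthProcess.exists_le_measure_forall_process_le` is the printed lower-bound form
  `P(max_n X^{λN}_n ≤ λN) ≥ 1 - ρ e^{-N}` for probability measures.
* `GrowthProcess.measure_exists_lt_process_le` — the explicit estimate behind it: for any
  initial range `X₀ ≤ N` whose columns of height `≥ 1` lie in a finite set `S`, any `K ≥ N - 1`
  and `t ∈ (0, 1]`,
  `P(∃ n, X^K_n > K) ≤ |S| (η(1+t)(1+2t))^{K+1-N} ((1+t)(1+2t)/t²)^{N-1}`.
* `GrowthProcess.IsRegular`, `GrowthProcess.mountain`, `GrowthProcess.mountain_le_step`,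
  `GrowthProcess.le_process_of_forall_step` — regular ranges, mountains `M(n, r)`, the covering
  step `X^{k+1} ≥ C(X^k)` and the comparison `H^k ≤ X^k` of GM14 §6.2 (the column heights `H^k_n`
  take values in `ℤ ∪ {-∞} = WithBot ℤ`; "`h ≤ C(R)_n`" is used in the attained form
  "`h ≤ M(l, R_l)_n` for some `l`").

## Proof

The printed proof (GM13 §3.4) represents the process by first-passage times on the directed
upper half-plane (horizontal edges cost `1`, downward `0`, upward `Geom(1-ζ)`), counts directed
paths, and bounds a binomial tail by Markov's inequality and Stirling's formula. We prove the
same estimate by a shorter union bound, which is the time-reversed form of the same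
representation: (1) *last-passage bound* `GrowthProcess.exists_path_le`: `X^K_n ≤ X₀(n₀) + `
(number of successful stays) for some nearest-neighbour path `n₀ → n` of length `K`, a stay at
time `j` in column `c` being successful when `Y^j_c = 1`; (2) hence `X^K_n ≥ K + 1` forces
`X₀(n₀) ≥ 1` and at least `m = K + 1 - N` successes among the `s ≤ K` stays of one of the
`|S| · 3^K` paths, an event of probability `≤ C(s, m) η^m` by the product bound; (3) the entropy is
beaten because `m` is close to `K`: `C(s, m) = C(s, s-m) ≤ (1+t)^K / t^{N-1}` and the number of
paths with `≥ m` stays is `≤ (1+2t)^K / t^{N-1}` (`Σ_{d} t^{#lateral steps} = (1+2t)^K`); (4) with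
`t = (1-η)/6` one has `q := η(1+t)(1+2t) ≤ η(2-η) < 1`, and `λ` is chosen with
`((1+t)(1+2t)/t²) q^{λ-1} ≤ e^{-2}`, giving `≤ |S| e^{-2N} ≤ 4ρN e^{-2N} ≤ ρ e^{-N}` for `N ≥ 6`.

## Locators

arXiv:1204.0505v2 numbers its theorem-like environments consecutively (the horizontal-crossing
proposition is "Proposition 15", the column-growth lemma "Lemma 17", the present lemma
"Lemma 18"); in the section-wise numbering used by the other `Isoradial*` files of this directory
these are Proposition 6.4, Lemma 6.6 and Lemma 6.7 of §6.2. In arXiv:1105.5535 (AoP 41 (2013)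
2990–3025) the growth process and the lemma are in §3.4 ("Lemma 22" consecutively, Lemma 3.11
section-wise, label `lem:growth_process_domination`), its proof at the end of §3.4.

## References

* G. R. Grimmett, I. Manolescu, *Bond percolation on isoradial graphs: criticality and
  universality*, Probab. Theory Related Fields 159 (2014) 273–327, arXiv:1204.0505, §6.2.
* G. R. Grimmett, I. Manolescu, *Inhomogeneous bond percolation on square, triangular and
  hexagonal lattices*, Ann. Probab. 41 (2013) 2990–3025, arXiv:1105.5535, §3.4.
-/

namespace Literature.Probability.Percolation

open _root_.MeasureTheory Finset
open scoped ENNReal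

namespace GrowthProcess

/-! ### The process -/

/-- One step of the growth process of Grimmett–Manolescu (AoP 41 (2013) §3.4, display before
Lemma 3.11; PTRF 159 (2014) §6.2, item (b) before Lemma 6.7:
"`X^{k+1}_n = max{X^k_{n-1}, X^k_n + Y^k_n, X^k_{n+1}}`"):
from the range `X : ℤ → ℤ` and the column indicators `Y : ℤ → Bool`, the new height in column `n`
is the larger of the two neighbouring heights and of the old height plus `Y n`.
[cite: GrimmettManolescu2014Isoradial, §6.2 item (b) before Lemma 6.7] -/
def step (Y : ℤ → Bool) (X : ℤ → ℤ) (n : ℤ) : ℤ :=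
  max (max (X (n - 1)) (X (n + 1))) (X n + (Y n).toNat)

/-- The growth process `X^k = (X^k_n : n ∈ ℤ)`, `k ≥ 0`, driven by the indicators
`Y : ℕ → ℤ → Bool` (`Y k n` = "`Y^k_n = 1`") from the initial range `X₀`:
`X^0 = X₀`, `X^{k+1} = step (Y k) X^k` (Grimmett–Manolescu, PTRF 159 (2014) §6.2, items (a)–(b)
before Lemma 6.7 = arXiv:1204.0505v2 Lemma 18; AoP 41 (2013) §3.4, items (a)–(b) before Lemma 3.11).
It is a deterministic function of the field `Y`; randomness enters only through `Y`.
[cite: GrimmettManolescu2014Isoradial, §6.2 items (a)–(b) before Lemma 6.7] -/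
def process (Y : ℕ → ℤ → Bool) (X₀ : ℤ → ℤ) : ℕ → ℤ → ℤ
  | 0 => X₀
  | k + 1 => step (Y k) (process Y X₀ k)

/-- `X^0 = X₀`. [folklore] -/
@[simp] theorem process_zero (Y : ℕ → ℤ → Bool) (X₀ : ℤ → ℤ) : process Y X₀ 0 = X₀ := rfl

/-- `X^{k+1} = step (Y k) X^k`. [folklore] -/
@[simp] theorem process_succ (Y : ℕ → ℤ → Bool) (X₀ : ℤ → ℤ) (k : ℕ) :
    process Y X₀ (k + 1) = step (Y k) (process Y X₀ k) := rfl

/-- The initial range of Grimmett–Manolescu 2014, §6.2 item (a): `X^0_n = N` for `|n| ≤ ρN` and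
`X^0_n = N + ρN - |n|` otherwise. [cite: GrimmettManolescu2014Isoradial, §6.2 item (a) before Lemma 6.7] -/
def initialRange (ρ N : ℕ) (n : ℤ) : ℤ := (N : ℤ) - max 0 (|n| - ρ * N)

/-- The initial range is bounded by `N`. [folklore] -/
theorem initialRange_le (ρ N : ℕ) (n : ℤ) : initialRange ρ N n ≤ N := by
  unfold initialRange
  have := le_max_left (0 : ℤ) (|n| - ρ * N)
  linarith

/-- The initial range equals `N` on `|n| ≤ ρN`. [folklore] -/
theorem initialRange_of_abs_le {ρ N : ℕ} {n : ℤ} (h : |n| ≤ ρ * N) : initialRange ρ N n = N := by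
  unfold initialRange
  rw [max_eq_left (by linarith)]
  ring

/-- The columns of initial height `≥ 1` are those with `|n| ≤ (ρ+1)N - 1`. [folklore] -/
theorem one_le_initialRange_iff {ρ N : ℕ} {n : ℤ} :
    1 ≤ initialRange ρ N n ↔ |n| ≤ (ρ + 1) * N - 1 := by
  unfold initialRange
  rcases le_total 0 (|n| - ρ * N) with h | h
  · rw [max_eq_right h]; constructor <;> intro <;> nlinarith
  · rw [max_eq_left h]
    have hN : (0 : ℤ) ≤ ρ * N := by positivity
    constructor <;> intro <;> nlinarith [abs_nonneg n]

/-! ### Paths and the last-passage bound -/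

/-- Column visited at time `j` by the path started in column `n₀` with steps `d 0, d 1, …`
(each in `{-1, 0, 1}`). [folklore] -/
def pos (n₀ : ℤ) (d : ℕ → SignType) (j : ℕ) : ℤ := n₀ + ∑ i ∈ range j, (d i : ℤ)

/-- The path starts at `n₀`. [folklore] -/
@[simp] theorem pos_zero (n₀ : ℤ) (d : ℕ → SignType) : pos n₀ d 0 = n₀ := by simp [pos]

/-- One more step. [folklore] -/
theorem pos_succ (n₀ : ℤ) (d : ℕ → SignType) (j : ℕ) :
    pos n₀ d (j + 1) = pos n₀ d j + d j := by
  simp [pos, sum_range_succ, add_assoc]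

/-- The position at time `j` depends only on the first `j` steps. [folklore] -/
theorem pos_congr {d d' : ℕ → SignType} {j : ℕ} (h : ∀ i < j, d i = d' i) (n₀ : ℤ) :
    pos n₀ d j = pos n₀ d' j := by
  unfold pos
  congr 1
  exact sum_congr rfl fun i hi => by rw [h i (mem_range.1 hi)]

/-- The number of *successful stays* of the path `(n₀, d)` before time `k`: times `j < k` at which
the path stays in its column (`d j = 0`) and the indicator `Y j` of that column is `1`. [folklore] -/
def gains (Y : ℕ → ℤ → Bool) (n₀ : ℤ) (d : ℕ → SignType) (k : ℕ) : ℕ :=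
  #((range k).filter fun j => d j = 0 ∧ Y j (pos n₀ d j) = true)

/-- At most `k` successful stays before time `k`. [folklore] -/
theorem gains_le (Y : ℕ → ℤ → Bool) (n₀ : ℤ) (d : ℕ → SignType) (k : ℕ) : gains Y n₀ d k ≤ k :=
  (card_filter_le _ _).trans (card_range k).le

/-- Successful stays before time `k + 1`. [folklore] -/
theorem gains_succ (Y : ℕ → ℤ → Bool) (n₀ : ℤ) (d : ℕ → SignType) (k : ℕ) :
    gains Y n₀ d (k + 1) =
      gains Y n₀ d k + if d k = 0 ∧ Y k (pos n₀ d k) = true then 1 else 0 := by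
  unfold gains
  rw [range_add_one, filter_insert]
  split_ifs with h
  · rw [card_insert_of_notMem (by simp)]
  · simp

/-- The successful stays before time `k` depend only on the first `k` steps. [folklore] -/
theorem gains_congr {Y : ℕ → ℤ → Bool} {d d' : ℕ → SignType} {k : ℕ} (h : ∀ i < k, d i = d' i)
    (n₀ : ℤ) : gains Y n₀ d k = gains Y n₀ d' k := by
  unfold gains
  congr 1
  refine filter_congr fun j hj => ?_
  have hj := mem_range.1 hj
  rw [h j hj, pos_congr (fun i hi => h i (hi.trans hj)) n₀]

/-- **Last-passage bound.** Every height of the growth process is bounded by the initial height at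
the start of some nearest-neighbour path ending in that column, plus the number of successful
stays along the path (the time-reversed form of the first-passage representation in the proof of
Grimmett–Manolescu, AoP 41 (2013), Lemma 3.11: "the state `G_k` at time `k` comprises exactly the
set of all vertices `D` such that there exists `C ∈ L_N` with `τ(C, D) ≤ k`").
[cite: GrimmettManolescuAOP2013, §3.4 proof of Lemma 3.11] -/
theorem exists_path_le (Y : ℕ → ℤ → Bool) (X₀ : ℤ → ℤ) (k : ℕ) (n : ℤ) :
    ∃ (n₀ : ℤ) (d : ℕ → SignType), pos n₀ d k = n ∧
      process Y X₀ k n ≤ X₀ n₀ + gains Y n₀ d k := by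
  induction k generalizing n with
  | zero => exact ⟨n, fun _ => 0, by simp, by simp [gains]⟩
  | succ k ih =>
    -- the three candidates for the maximum, each with a witness path of length `k`
    have key : ∀ (a : SignType) (n' : ℤ), n' + a = n →
        ∃ (n₀ : ℤ) (d : ℕ → SignType), pos n₀ d (k + 1) = n ∧ d k = a ∧ pos n₀ d k = n' ∧
          process Y X₀ k n' ≤ X₀ n₀ + gains Y n₀ d k := by
      intro a n' hn'
      obtain ⟨n₀, d, hpos, hle⟩ := ih n'
      refine ⟨n₀, Function.update d k a, ?_, by simp, ?_, ?_⟩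
      · rw [pos_succ, pos_congr (d' := d) (fun i hi => Function.update_of_ne hi.ne _ _), hpos]
        simpa using hn'
      · rw [pos_congr (d' := d) (fun i hi => Function.update_of_ne hi.ne _ _), hpos]
      · rwa [gains_congr (d' := d) (fun i hi => Function.update_of_ne hi.ne _ _)]
    simp only [process_succ, step]
    rcases le_total (max (process Y X₀ k (n - 1)) (process Y X₀ k (n + 1)))
        (process Y X₀ k n + ((Y k n).toNat : ℤ)) with hmax | hmax
    · -- the stay term wins
      rw [max_eq_right hmax]
      obtain ⟨n₀, d, hpos, hdk, hposk, hle⟩ := key 0 n (by simp)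
      refine ⟨n₀, d, hpos, ?_⟩
      rw [gains_succ, hposk]
      simp only [hdk, true_and]
      cases Y k n <;> simp <;> omega
    · rw [max_eq_left hmax]
      rcases le_total (process Y X₀ k (n - 1)) (process Y X₀ k (n + 1)) with h2 | h2
      · rw [max_eq_right h2]
        obtain ⟨n₀, d, hpos, hdk, -, hle⟩ := key (-1) (n + 1) (by simp)
        refine ⟨n₀, d, hpos, hle.trans ?_⟩
        rw [gains_succ]
        simp [hdk]
      · rw [max_eq_left h2]
        obtain ⟨n₀, d, hpos, hdk, -, hle⟩ := key 1 (n - 1) (by simp)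
        refine ⟨n₀, d, hpos, hle.trans ?_⟩
        rw [gains_succ]
        simp [hdk]


/-! ### The bad event is covered by finitely many path events -/

/-- Extension by `0` of a finite step sequence. [folklore] -/
def ext (K : ℕ) (d' : Fin K → SignType) : ℕ → SignType :=
  fun i => if h : i < K then d' ⟨i, h⟩ else 0

/-- `ext K d'` agrees with `d'` below `K`. [folklore] -/
theorem ext_apply_of_lt {K : ℕ} (d' : Fin K → SignType) {i : ℕ} (hi : i < K) :
    ext K d' i = d' ⟨i, hi⟩ := by
  simp [ext, hi]

/-- The stays (`d j = 0`) of a step sequence before time `K`. [folklore] -/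
def stays (K : ℕ) (d : ℕ → SignType) : Finset ℕ := (range K).filter fun j => d j = 0

/-- The number of stays of `ext K d'` is the number of zero entries of `d'`. [folklore] -/
theorem card_stays_ext (K : ℕ) (d' : Fin K → SignType) :
    #(stays K (ext K d')) = #(univ.filter fun i : Fin K => d' i = 0) := by
  unfold stays
  rw [card_filter, card_filter, sum_range]
  refine sum_congr rfl fun i _ => ?_
  rw [ext_apply_of_lt d' i.isLt]

/-- Stays plus lateral steps make up all `K` steps. [folklore] -/
theorem card_stays_add_card_filter_ne (K : ℕ) (d' : Fin K → SignType) :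
    #(stays K (ext K d')) + #(univ.filter fun i : Fin K => d' i ≠ 0) = K := by
  rw [card_stays_ext, card_filter_add_card_filter_not, card_univ, Fintype.card_fin]

variable {Ω : Type*}

/-- If some height of `X^K` exceeds `K`, then along one of finitely many paths — start `n₀` with
`X₀ n₀ ≥ 1`, steps `d' : Fin K → {-1, 0, 1}` — at least `K + 1 - N` stays were successful
(`X₀ ≤ N` throughout). [cite: GrimmettManolescuAOP2013, §3.4 proof of Lemma 3.11] -/
theorem setOf_exists_lt_process_subset (Y : ℕ → ℤ → Ω → Bool) (X₀ : ℤ → ℤ) {N : ℕ} (K : ℕ)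
    (hX₀ : ∀ n, X₀ n ≤ N) {S : Finset ℤ} (hS : ∀ n, 1 ≤ X₀ n → n ∈ S) :
    {ω | ∃ n, (K : ℤ) < process (fun k l => Y k l ω) X₀ K n} ⊆
      ⋃ n₀ ∈ S, ⋃ d' : Fin K → SignType,
        {ω | K + 1 - N ≤ gains (fun k l => Y k l ω) n₀ (ext K d') K} := by
  rintro ω ⟨n, hn⟩
  obtain ⟨n₀, d, -, hle⟩ := exists_path_le (fun k l => Y k l ω) X₀ K n
  have hg := gains_le (fun k l => Y k l ω) n₀ d K
  have hX := hX₀ n₀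
  have h1 : 1 ≤ X₀ n₀ := by omega
  simp only [Set.mem_iUnion, Set.mem_setOf_eq, exists_prop]
  refine ⟨n₀, hS n₀ h1, fun i => d i, ?_⟩
  rw [← gains_congr (d := d) (d' := ext K fun i => d i) (fun i hi => by simp [ext, hi])]
  omega

/-- **One path.** Under the product bound `P(Y_i = 1 ∀ i ∈ T) ≤ q^{|T|}`, the probability that a
given path has at least `m` successful stays before time `K` is at most `C(s, m) q^m`, `s` its
number of stays (union bound over the `m`-subsets of stays).
[cite: GrimmettManolescuAOP2013, §3.4 proof of Lemma 3.11] -/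
theorem measure_le_gains_le [MeasurableSpace Ω] (P : Measure Ω) (Y : ℕ → ℤ → Ω → Bool) {q : ℝ≥0∞}
    (hY : ∀ T : Finset (ℕ × ℤ), P {ω | ∀ i ∈ T, Y i.1 i.2 ω = true} ≤ q ^ #T)
    (n₀ : ℤ) (d : ℕ → SignType) (K m : ℕ) :
    P {ω | m ≤ gains (fun k l => Y k l ω) n₀ d K} ≤ (#(stays K d)).choose m * q ^ m := by
  classical
  have hsub : {ω | m ≤ gains (fun k l => Y k l ω) n₀ d K} ⊆
      ⋃ T ∈ powersetCard m (stays K d), {ω | ∀ j ∈ T, Y j (pos n₀ d j) ω = true} := by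
    intro ω hω
    simp only [Set.mem_setOf_eq, gains] at hω
    obtain ⟨T, hTG, hT⟩ := exists_subset_card_eq hω
    simp only [Set.mem_iUnion, Set.mem_setOf_eq, exists_prop, mem_powersetCard]
    refine ⟨T, ⟨fun j hj => ?_, hT⟩, fun j hj => ?_⟩
    · have := hTG hj
      simp only [mem_filter] at this
      exact mem_filter.2 ⟨this.1, this.2.1⟩
    · have := hTG hj
      simp only [mem_filter] at this
      exact this.2.2
  calc P {ω | m ≤ gains (fun k l => Y k l ω) n₀ d K}
      ≤ P (⋃ T ∈ powersetCard m (stays K d), {ω | ∀ j ∈ T, Y j (pos n₀ d j) ω = true}) :=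
        measure_mono hsub
    _ ≤ ∑ T ∈ powersetCard m (stays K d), P {ω | ∀ j ∈ T, Y j (pos n₀ d j) ω = true} :=
        measure_biUnion_finset_le _ _
    _ ≤ ∑ T ∈ powersetCard m (stays K d), q ^ m := by
        refine sum_le_sum fun T hT => ?_
        have hTm : #T = m := (mem_powersetCard.1 hT).2
        -- relabel the stays of `T` as index pairs `(j, column)`
        set φ : ℕ → ℕ × ℤ := fun j => (j, pos n₀ d j) with hφ
        have hinj : Function.Injective φ := fun a b h => by
          simpa [hφ] using congrArg Prod.fst h
        have hset : {ω | ∀ j ∈ T, Y j (pos n₀ d j) ω = true} =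
            {ω | ∀ i ∈ T.image φ, Y i.1 i.2 ω = true} := by
          ext ω
          simp [hφ]
        rw [hset]
        refine (hY _).trans_eq ?_
        rw [card_image_of_injective _ hinj, hTm]
    _ = (#(stays K d)).choose m * q ^ m := by
        rw [sum_const, card_powersetCard, nsmul_eq_mul]

/-- **Union bound.** Under the product bound, the probability that some height of `X^K` exceeds
`K` is at most `|S| · Σ_{d'} C(s(d'), K+1-N) q^{K+1-N}`.
[cite: GrimmettManolescuAOP2013, §3.4 proof of Lemma 3.11] -/
theorem measure_exists_lt_process_le_sum [MeasurableSpace Ω] (P : Measure Ω)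
    (Y : ℕ → ℤ → Ω → Bool) {q : ℝ≥0∞}
    (hY : ∀ T : Finset (ℕ × ℤ), P {ω | ∀ i ∈ T, Y i.1 i.2 ω = true} ≤ q ^ #T)
    (X₀ : ℤ → ℤ) {N : ℕ} (K : ℕ) (hX₀ : ∀ n, X₀ n ≤ N) {S : Finset ℤ}
    (hS : ∀ n, 1 ≤ X₀ n → n ∈ S) :
    P {ω | ∃ n, (K : ℤ) < process (fun k l => Y k l ω) X₀ K n} ≤
      #S * ∑ d' : Fin K → SignType,
        ((#(stays K (ext K d'))).choose (K + 1 - N) : ℝ≥0∞) * q ^ (K + 1 - N) := by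
  calc P {ω | ∃ n, (K : ℤ) < process (fun k l => Y k l ω) X₀ K n}
      ≤ P (⋃ n₀ ∈ S, ⋃ d' : Fin K → SignType,
          {ω | K + 1 - N ≤ gains (fun k l => Y k l ω) n₀ (ext K d') K}) :=
        measure_mono (setOf_exists_lt_process_subset Y X₀ K hX₀ hS)
    _ ≤ ∑ n₀ ∈ S, P (⋃ d' : Fin K → SignType,
          {ω | K + 1 - N ≤ gains (fun k l => Y k l ω) n₀ (ext K d') K}) :=
        measure_biUnion_finset_le _ _
    _ ≤ ∑ n₀ ∈ S, ∑ d' : Fin K → SignType,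
          P {ω | K + 1 - N ≤ gains (fun k l => Y k l ω) n₀ (ext K d') K} :=
        sum_le_sum fun _ _ => measure_iUnion_fintype_le _ _
    _ ≤ ∑ _n₀ ∈ S, ∑ d' : Fin K → SignType,
          ((#(stays K (ext K d'))).choose (K + 1 - N) : ℝ≥0∞) * q ^ (K + 1 - N) :=
        sum_le_sum fun _ _ => sum_le_sum fun d' _ => measure_le_gains_le P Y hY _ _ _ _
    _ = _ := by rw [sum_const, nsmul_eq_mul]

/-! ### Counting -/

/-- `Σ_{d' : Fin K → {-1,0,1}} t^{#lateral steps of d'} = (1 + 2t)^K`. [folklore] -/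
theorem sum_pow_card_filter_ne_zero (K : ℕ) (t : ℝ) :
    ∑ d' : Fin K → SignType, t ^ #(univ.filter fun i : Fin K => d' i ≠ 0) = (1 + 2 * t) ^ K := by
  classical
  have hw : ∀ d' : Fin K → SignType,
      t ^ #(univ.filter fun i : Fin K => d' i ≠ 0) = ∏ i, (if d' i ≠ 0 then t else 1) := by
    intro d'
    rw [prod_ite, prod_const, prod_const_one, mul_one]
  simp_rw [hw]
  rw [← Fintype.piFinset_univ, ← prod_univ_sum (fun _ : Fin K => (univ : Finset SignType))
    (fun _ a => if a ≠ 0 then t else 1)]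
  simp [SignType.univ_eq, prod_const]
  ring

/-- The binomial estimate `C(s, m) ≤ (1 + t)^K / t^{N-1}` for `m = K + 1 - N ≤ s ≤ K`, `0 < t ≤ 1`
(from `C(s, s - m) t^{s-m} ≤ (1 + t)^s` and `s - m ≤ N - 1`). [folklore] -/
theorem choose_le_pow_div {s K N : ℕ} (hs : s ≤ K) (hN : 1 ≤ N) (hNK : N ≤ K + 1)
    (hm : K + 1 - N ≤ s) {t : ℝ} (ht0 : 0 < t) (ht1 : t ≤ 1) :
    (s.choose (K + 1 - N) : ℝ) ≤ (1 + t) ^ K / t ^ (N - 1) := by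
  set m := K + 1 - N with hm'
  have hsm : s - m ≤ N - 1 := by omega
  -- `C(s, s-m) t^(s-m)` is one term of the binomial expansion of `(t + 1)^s`
  have hterm : (s.choose m : ℝ) * t ^ (s - m) ≤ (1 + t) ^ s := by
    rw [add_comm, add_pow]
    have hmem : s - m ∈ range (s + 1) := mem_range.2 (by omega)
    refine le_trans ?_ (single_le_sum (f := fun i => t ^ i * 1 ^ (s - i) * (s.choose i : ℝ))
      (fun i _ => by positivity) hmem)
    simp only [one_pow, mul_one]
    rw [Nat.choose_symm (by omega : m ≤ s), mul_comm]
  have htpow : t ^ (N - 1) ≤ t ^ (s - m) := pow_le_pow_of_le_one ht0.le ht1 hsm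
  have hpowK : (1 + t) ^ s ≤ (1 + t) ^ K := pow_le_pow_right₀ (by linarith) hs
  rw [le_div_iff₀ (by positivity)]
  calc (s.choose m : ℝ) * t ^ (N - 1) ≤ (s.choose m : ℝ) * t ^ (s - m) := by gcongr
    _ ≤ (1 + t) ^ s := hterm
    _ ≤ (1 + t) ^ K := hpowK

/-- **Entropy bound.** `Σ_{d'} C(s(d'), K+1-N) ≤ ((1+t)(1+2t))^K / t^{2(N-1)}` for `0 < t ≤ 1`,
`1 ≤ N ≤ K + 1`. [folklore] -/
theorem sum_choose_stays_le (K : ℕ) {N : ℕ} (hN : 1 ≤ N) (hNK : N ≤ K + 1) {t : ℝ} (ht0 : 0 < t)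
    (ht1 : t ≤ 1) :
    ∑ d' : Fin K → SignType, ((#(stays K (ext K d'))).choose (K + 1 - N) : ℝ) ≤
      ((1 + t) * (1 + 2 * t)) ^ K / t ^ (2 * (N - 1)) := by
  have key : ∀ d' : Fin K → SignType,
      ((#(stays K (ext K d'))).choose (K + 1 - N) : ℝ) ≤
        t ^ #(univ.filter fun i : Fin K => d' i ≠ 0) * ((1 + t) ^ K / t ^ (2 * (N - 1))) := by
    intro d'
    have hsum := card_stays_add_card_filter_ne K d'
    set s := #(stays K (ext K d'))
    set l := #(univ.filter fun i : Fin K => d' i ≠ 0)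
    by_cases hm : K + 1 - N ≤ s
    · have hl : l ≤ N - 1 := by omega
      have h1 := choose_le_pow_div (s := s) (K := K) (N := N) (by omega) hN hNK hm ht0 ht1
      have htl : t ^ (N - 1) ≤ t ^ l := pow_le_pow_of_le_one ht0.le ht1 hl
      calc (s.choose (K + 1 - N) : ℝ) ≤ (1 + t) ^ K / t ^ (N - 1) := h1
        _ = t ^ (N - 1) * ((1 + t) ^ K / t ^ (2 * (N - 1))) := by
            rw [two_mul, pow_add]; field_simp
        _ ≤ t ^ l * ((1 + t) ^ K / t ^ (2 * (N - 1))) := by gcongr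
    · rw [Nat.choose_eq_zero_of_lt (by omega)]
      simp only [Nat.cast_zero]
      positivity
  calc ∑ d' : Fin K → SignType, ((#(stays K (ext K d'))).choose (K + 1 - N) : ℝ)
      ≤ ∑ d' : Fin K → SignType,
          t ^ #(univ.filter fun i : Fin K => d' i ≠ 0) * ((1 + t) ^ K / t ^ (2 * (N - 1))) :=
        sum_le_sum fun d' _ => key d'
    _ = (1 + 2 * t) ^ K * ((1 + t) ^ K / t ^ (2 * (N - 1))) := by
        rw [← sum_mul, sum_pow_card_filter_ne_zero]
    _ = ((1 + t) * (1 + 2 * t)) ^ K / t ^ (2 * (N - 1)) := by rw [mul_pow]; ring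


/-! ### The main estimate -/

/-- **Growth-process estimate, explicit form.** Under the product bound with parameter `η ≥ 0`,
for an initial range `X₀ ≤ N` whose columns of height `≥ 1` lie in the finite set `S`, and any
`t ∈ (0, 1]`,
`P(∃ n, X^K_n > K) ≤ |S| · (η (1+t)(1+2t))^{K+1-N} · ((1+t)(1+2t)/t²)^{N-1}`.
(A direct union-bound proof of the estimate of Grimmett–Manolescu, AoP 41 (2013) Lemma 3.11 /
PTRF 159 (2014) Lemma 6.7; the printed proof goes through first-passage times and Stirling's
formula, the estimate landed here replaces that by the binomial identity
`Σ_{d'} t^{#lateral steps} = (1+2t)^K`.) [cite: GrimmettManolescuAOP2013, §3.4 Lemma 3.11] -/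
theorem measure_exists_lt_process_le [MeasurableSpace Ω] (P : Measure Ω) (Y : ℕ → ℤ → Ω → Bool)
    {η : ℝ} (hη : 0 ≤ η)
    (hY : ∀ T : Finset (ℕ × ℤ), P {ω | ∀ i ∈ T, Y i.1 i.2 ω = true} ≤ ENNReal.ofReal η ^ #T)
    (X₀ : ℤ → ℤ) {N K : ℕ} (hN : 1 ≤ N) (hNK : N ≤ K + 1) (hX₀ : ∀ n, X₀ n ≤ N) {S : Finset ℤ}
    (hS : ∀ n, 1 ≤ X₀ n → n ∈ S) {t : ℝ} (ht0 : 0 < t) (ht1 : t ≤ 1) :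
    P {ω | ∃ n, (K : ℤ) < process (fun k l => Y k l ω) X₀ K n} ≤
      ENNReal.ofReal (#S * ((η * ((1 + t) * (1 + 2 * t))) ^ (K + 1 - N) *
        (((1 + t) * (1 + 2 * t)) / t ^ 2) ^ (N - 1))) := by
  refine (measure_exists_lt_process_le_sum P Y hY X₀ K hX₀ hS).trans ?_
  set C : (Fin K → SignType) → ℕ := fun d' => (#(stays K (ext K d'))).choose (K + 1 - N) with hC
  have hreal : (#S : ℝ≥0∞) * ∑ d' : Fin K → SignType, (C d' : ℝ≥0∞) * ENNReal.ofReal η ^ (K + 1 - N)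
      = ENNReal.ofReal (#S * ((∑ d' : Fin K → SignType, (C d' : ℝ)) * η ^ (K + 1 - N))) := by
    rw [ENNReal.ofReal_mul (by positivity), ENNReal.ofReal_natCast,
      ENNReal.ofReal_mul (sum_nonneg fun _ _ => by positivity), ← ENNReal.ofReal_pow hη,
      ENNReal.ofReal_sum_of_nonneg (fun _ _ => by positivity), sum_mul]
    congr 1
    refine sum_congr rfl fun d' _ => ?_
    rw [ENNReal.ofReal_natCast]
  rw [hreal]
  refine ENNReal.ofReal_le_ofReal ?_
  have hsum := sum_choose_stays_le K hN hNK ht0 ht1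
  set B : ℝ := (1 + t) * (1 + 2 * t) with hB
  have hB0 : 0 < B := by positivity
  clear_value B
  have hBK : B ^ K = B ^ (K + 1 - N) * B ^ (N - 1) := by
    rw [← pow_add]; congr 1; omega
  calc (#S : ℝ) * ((∑ d' : Fin K → SignType, (C d' : ℝ)) * η ^ (K + 1 - N))
      ≤ #S * (B ^ K / t ^ (2 * (N - 1)) * η ^ (K + 1 - N)) := by gcongr
    _ = #S * ((η * B) ^ (K + 1 - N) * (B / t ^ 2) ^ (N - 1)) := by
        rw [hBK, mul_pow η B (K + 1 - N), div_pow, ← pow_mul]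
        ring

/-- The arithmetic behind the choice of constants: with `A q^j ≤ e^{-2}`, `q ∈ [0,1]`, `A ≥ 1`,
`ρ ≥ 1` and `N ≥ 6`, `(2(ρ+1)N - 1) · q^{(j+1)N+1-N} · A^{N-1} ≤ ρ e^{-N}`. [folklore] -/
theorem card_mul_pow_mul_pow_le {ρ N j : ℕ} (hρ : 1 ≤ ρ) (hN : 6 ≤ N) {A q : ℝ} (hA : 1 ≤ A)
    (hq0 : 0 ≤ q) (hq1 : q ≤ 1) (hj : A * q ^ j ≤ Real.exp (-2)) :
    ((2 * (ρ + 1) * N - 1 : ℕ) : ℝ) * (q ^ ((j + 1) * N + 1 - N) * A ^ (N - 1)) ≤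
      ρ * Real.exp (-N) := by
  have hcard : ((2 * (ρ + 1) * N - 1 : ℕ) : ℝ) ≤ 4 * ρ * N := by
    have h : 2 * (ρ + 1) * N - 1 ≤ 4 * ρ * N := by
      have : 2 * (ρ + 1) * N ≤ 4 * ρ * N + 1 := by nlinarith
      omega
    exact_mod_cast h
  have hqpow : q ^ ((j + 1) * N + 1 - N) ≤ (q ^ j) ^ N := by
    rw [← pow_mul]
    exact pow_le_pow_of_le_one hq0 hq1 (by
      have : (j + 1) * N + 1 - N = j * N + 1 := by
        rw [add_mul, one_mul]; omega
      omega)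
  have hApow : A ^ (N - 1) ≤ A ^ N := pow_le_pow_right₀ hA (Nat.sub_le N 1)
  have hAq : (q ^ j) ^ N * A ^ N ≤ Real.exp (-2) ^ N := by
    rw [← mul_pow, mul_comm]
    exact pow_le_pow_left₀ (by positivity) hj N
  have hexp2 : Real.exp (-2) ^ N = Real.exp (-N) * Real.exp (-N) := by
    rw [← Real.exp_nat_mul, ← Real.exp_add]; congr 1; ring
  -- `4 N e^{-N} ≤ 1` for `N ≥ 6`
  have hN' : (6 : ℝ) ≤ N := by exact_mod_cast hN
  have h4N : 4 * (N : ℝ) * Real.exp (-N) ≤ 1 := by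
    have hq := Real.quadratic_le_exp_of_nonneg (x := (N : ℝ)) (by positivity)
    have h4 : 4 * (N : ℝ) ≤ Real.exp N := by nlinarith
    have : Real.exp (N : ℝ) * Real.exp (-N) = 1 := by rw [← Real.exp_add]; simp
    nlinarith [Real.exp_pos (-(N : ℝ))]
  calc ((2 * (ρ + 1) * N - 1 : ℕ) : ℝ) * (q ^ ((j + 1) * N + 1 - N) * A ^ (N - 1))
      ≤ (4 * ρ * N) * ((q ^ j) ^ N * A ^ N) := by gcongr
    _ ≤ (4 * ρ * N) * Real.exp (-2) ^ N := by gcongr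
    _ = ρ * Real.exp (-N) * (4 * N * Real.exp (-N)) := by rw [hexp2]; ring
    _ ≤ ρ * Real.exp (-N) * 1 := by gcongr
    _ = ρ * Real.exp (-N) := mul_one _

/-- **Grimmett–Manolescu's growth-process lemma** (PTRF 159 (2014) = arXiv:1204.0505, §6.2,
Lemma 6.7 (Lemma 18 of the sequentially numbered arXiv v2), attributed there to AoP 41 (2013),
§3.4, Lemma 3.11): "There exist `λ, N₀ ∈ ℕ`, depending on `η` only, such that
`P(max_n X^{λN}_n ≤ λN) ≥ 1 - ρ e^{-N}`, `ρ ∈ ℕ`, `N ≥ N₀`", for the growth process (a)–(b) with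
independent Bernoulli(`η`) variables `Y^k_n` and the initial range `X^0_n = N` (`|n| ≤ ρN`),
`X^0_n = N + ρN - |n|` (`|n| > ρN`). This is the upper-bound form `P(∃ n, X^{λN}_n > λN) ≤ ρ e^{-N}`,
valid for every measure `P` and every family `Y` satisfying only the *product bound*
`P(Y^k_n = 1 ∀ (k, n) ∈ T) ≤ η^{|T|}` for finite `T` (which holds for independent Bernoulli
variables of parameters `≤ η`, see `productBound_of_iIndepFun`); here `N₀ = 6`.
[cite: GrimmettManolescu2014Isoradial, §6.2 Lemma 6.7] -/
theorem exists_measure_exists_lt_process_le {η : ℝ} (hη0 : 0 ≤ η) (hη1 : η < 1) :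
    ∃ lam N₀ : ℕ, 1 ≤ lam ∧ ∀ (ρ N : ℕ), 1 ≤ ρ → N₀ ≤ N →
      ∀ {Ω : Type*} [MeasurableSpace Ω] (P : Measure Ω) (Y : ℕ → ℤ → Ω → Bool),
        (∀ T : Finset (ℕ × ℤ), P {ω | ∀ i ∈ T, Y i.1 i.2 ω = true} ≤ ENNReal.ofReal η ^ #T) →
        P {ω | ∃ n, (lam * N : ℤ) <
            process (fun k l => Y k l ω) (initialRange ρ N) (lam * N) n} ≤
          ENNReal.ofReal (ρ * Real.exp (-N)) := by
  -- constants
  set t : ℝ := (1 - η) / 6 with ht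
  have ht0 : 0 < t := by rw [ht]; linarith
  have ht1 : t ≤ 1 := by rw [ht]; linarith
  set B : ℝ := (1 + t) * (1 + 2 * t) with hB
  have hB1 : 1 ≤ B := by rw [hB]; nlinarith
  have hB2 : B ≤ 2 - η := by rw [hB, ht]; nlinarith
  set q : ℝ := η * B with hq
  have hq0 : 0 ≤ q := by positivity
  have hq1 : q < 1 := by rw [hq]; nlinarith
  set A : ℝ := B / t ^ 2 with hA
  have hA1 : 1 ≤ A := by
    rw [hA, one_le_div (by positivity)]
    nlinarith
  -- `A q^j → 0`
  have hlim : Filter.Tendsto (fun j : ℕ => A * q ^ j) Filter.atTop (nhds 0) := by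
    simpa using (tendsto_pow_atTop_nhds_zero_of_lt_one hq0 hq1).const_mul A
  obtain ⟨j, hj⟩ := ((tendsto_order.1 hlim).2 _ (Real.exp_pos (-2))).exists
  refine ⟨j + 1, 6, by omega, fun ρ N hρ hN Ω _ P Y hY => ?_⟩
  have hN1 : 1 ≤ N := by omega
  -- the relevant starting columns
  set M : ℕ := (ρ + 1) * N with hM
  have hM1 : 1 ≤ M := Nat.one_le_iff_ne_zero.2 (by positivity)
  have hMz : ((M : ℕ) : ℤ) = (ρ + 1) * N := by rw [hM]; push_cast; ring
  set S : Finset ℤ := Icc (1 - (M : ℤ)) ((M : ℤ) - 1) with hS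
  have hSmem : ∀ n, 1 ≤ initialRange ρ N n → n ∈ S := by
    intro n hn
    rw [one_le_initialRange_iff, ← hMz] at hn
    rw [hS, mem_Icc]
    constructor <;> linarith [le_abs_self n, neg_abs_le n]
  have hScard : #S = 2 * (ρ + 1) * N - 1 := by
    rw [hS, Int.card_Icc, Nat.mul_assoc, ← hM]
    have : (M : ℤ) - 1 + 1 - (1 - M) = ((2 * M - 1 : ℕ) : ℤ) := by omega
    rw [this, Int.toNat_natCast]
  have hmain := measure_exists_lt_process_le P Y hη0 hY (initialRange ρ N) (N := N) (K := (j + 1) * N)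
    hN1 (by nlinarith) (initialRange_le ρ N) hSmem ht0 ht1
  push_cast at hmain ⊢
  refine hmain.trans (ENNReal.ofReal_le_ofReal ?_)
  rw [hScard]
  exact card_mul_pow_mul_pow_le hρ hN hA1 hq0 hq1.le hj.le

/-- The printed lower-bound form of Grimmett–Manolescu's growth-process lemma (PTRF 159 (2014)
§6.2 Lemma 6.7; AoP 41 (2013) Lemma 3.11): for a probability measure,
`P(max_n X^{λN}_n ≤ λN) ≥ 1 - ρ e^{-N}` for `ρ ≥ 1`, `N ≥ N₀`.
[cite: GrimmettManolescu2014Isoradial, §6.2 Lemma 6.7] -/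
theorem exists_le_measure_forall_process_le {η : ℝ} (hη0 : 0 ≤ η) (hη1 : η < 1) :
    ∃ lam N₀ : ℕ, 1 ≤ lam ∧ ∀ (ρ N : ℕ), 1 ≤ ρ → N₀ ≤ N →
      ∀ {Ω : Type*} [MeasurableSpace Ω] (P : Measure Ω) [IsProbabilityMeasure P]
        (Y : ℕ → ℤ → Ω → Bool),
        (∀ T : Finset (ℕ × ℤ), P {ω | ∀ i ∈ T, Y i.1 i.2 ω = true} ≤ ENNReal.ofReal η ^ #T) →
        ENNReal.ofReal (1 - ρ * Real.exp (-N)) ≤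
          P {ω | ∀ n, process (fun k l => Y k l ω) (initialRange ρ N) (lam * N) n ≤ lam * N} := by
  obtain ⟨lam, N₀, hlam, h⟩ := exists_measure_exists_lt_process_le hη0 hη1
  refine ⟨lam, N₀, hlam, fun ρ N hρ hN Ω _ P _ Y hY => ?_⟩
  have hbad := h ρ N hρ hN P Y hY
  set bad : Set Ω := {ω | ∃ n, (lam * N : ℤ) <
      process (fun k l => Y k l ω) (initialRange ρ N) (lam * N) n} with hbad_def
  have hcompl : {ω | ∀ n, process (fun k l => Y k l ω) (initialRange ρ N) (lam * N) n ≤ lam * N}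
      = badᶜ := by
    ext ω; simp [hbad_def]
  rw [hcompl, ENNReal.ofReal_sub _ (by positivity), ENNReal.ofReal_one]
  have h1 : (1 : ℝ≥0∞) ≤ P badᶜ + P bad := by
    rw [← measure_univ (μ := P), ← Set.compl_union_self bad]
    exact measure_union_le _ _
  calc 1 - ENNReal.ofReal (ρ * Real.exp (-N)) ≤ 1 - P bad := tsub_le_tsub_left hbad _
    _ ≤ P badᶜ := tsub_le_iff_right.2 h1

/-- The product bound from independence: if the `Y^k_n` are independent with
`P(Y^k_n = 1) ≤ q`, then `P(Y_i = 1 ∀ i ∈ T) ≤ q^{|T|}` for every finite `T`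
(Grimmett–Manolescu's hypothesis "independent Bernoulli random variables with common parameter
`η`", PTRF 159 (2014) §6.2 Lemma 6.6). [folklore] -/
theorem productBound_of_iIndepFun [MeasurableSpace Ω] {P : Measure Ω} (Y : ℕ → ℤ → Ω → Bool)
    (hind : ProbabilityTheory.iIndepFun (fun i : ℕ × ℤ => Y i.1 i.2) P) {q : ℝ≥0∞}
    (hq : ∀ k n, P (Y k n ⁻¹' {true}) ≤ q) (T : Finset (ℕ × ℤ)) :
    P {ω | ∀ i ∈ T, Y i.1 i.2 ω = true} ≤ q ^ #T := by
  have hset : {ω | ∀ i ∈ T, Y i.1 i.2 ω = true} = ⋂ i ∈ T, (fun ω => Y i.1 i.2 ω) ⁻¹' {true} := by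
    ext ω; simp
  rw [hset, hind.meas_biInter (fun i _ => ⟨{true}, MeasurableSet.of_discrete, rfl⟩)]
  exact prod_le_pow_card _ _ _ fun i _ => hq i.1 i.2


/-! ### Regular ranges, mountains, and the comparison step of Grimmett–Manolescu 2014 -/

/-- A range `R : ℤ → ℤ` is *regular* if `|R_{n+1} - R_n| ≤ 1` for all `n`
(Grimmett–Manolescu, PTRF 159 (2014) §6.2, display before the definition of mountains).
[cite: GrimmettManolescu2014Isoradial, §6.2 proof of Prop 6.4] -/
def IsRegular (R : ℤ → ℤ) : Prop := ∀ n, |R (n + 1) - R n| ≤ 1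

/-- A regular range is `1`-Lipschitz. [folklore] -/
theorem IsRegular.le_add_abs {R : ℤ → ℤ} (hR : IsRegular R) (a b : ℤ) : R a ≤ R b + |a - b| := by
  refine Int.inductionOn' (motive := fun a => R a ≤ R b + |a - b|) a b ?_ ?_ ?_
  · simp
  · intro a hab ih
    have h := hR a
    rw [abs_le] at h
    rw [abs_of_nonneg (by omega)] at ih ⊢
    omega
  · intro a hab ih
    have h := hR (a - 1)
    rw [sub_add_cancel, abs_le] at h
    rw [abs_of_nonpos (by omega)] at ih ⊢
    omega

/-- "It is immediate that `X^0` is regular" (Grimmett–Manolescu 2014, §6.2).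
[cite: GrimmettManolescu2014Isoradial, §6.2 proof of Prop 6.4] -/
theorem isRegular_initialRange (ρ N : ℕ) : IsRegular (initialRange ρ N) := by
  intro n
  unfold initialRange
  rw [abs_le]
  constructor <;>
  · rcases le_total 0 (|n + 1| - ρ * N) with h1 | h1 <;>
    rcases le_total 0 (|n| - ρ * N) with h2 | h2 <;>
    simp only [max_eq_right, max_eq_left, h1, h2] <;>
    cases abs_cases (n + 1) <;> cases abs_cases n <;> omega

/-- One step of the growth process preserves regularity (Grimmett–Manolescu 2014, §6.2: "By
(X_evolution) [the recursion (b)], each range `X^k` is regular"). [cite: GrimmettManolescu2014Isoradial, §6.2 proof of Prop 6.4] -/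
theorem IsRegular.step {X : ℤ → ℤ} (hX : IsRegular X) (Y : ℤ → Bool) :
    IsRegular (GrowthProcess.step Y X) := by
  intro n
  have h1 := hX n
  have h2 := hX (n + 1)
  have h0 := hX (n - 1)
  rw [sub_add_cancel] at h0
  rw [abs_le] at h1 h2 h0 ⊢
  simp only [GrowthProcess.step, add_sub_cancel_right]
  have hY1 : ((Y n).toNat : ℤ) ≤ 1 := by cases Y n <;> simp
  have hY2 : ((Y (n + 1)).toNat : ℤ) ≤ 1 := by cases Y (n + 1) <;> simp
  have hY1' : 0 ≤ ((Y n).toNat : ℤ) := by positivity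
  have hY2' : 0 ≤ ((Y (n + 1)).toNat : ℤ) := by positivity
  rw [show n + 1 + 1 = n + 2 from by ring] at h2 ⊢
  constructor
  · simp only [le_sub_iff_add_le, neg_add_le_iff_le_add, max_le_iff, le_max_iff]
    omega
  · simp only [sub_le_iff_le_add, max_le_iff]
    omega

/-- "Each range `X^k` is regular" (Grimmett–Manolescu 2014, §6.2).
[cite: GrimmettManolescu2014Isoradial, §6.2 proof of Prop 6.4] -/
theorem isRegular_process {X₀ : ℤ → ℤ} (hX₀ : IsRegular X₀) (Y : ℕ → ℤ → Bool) (k : ℕ) :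
    IsRegular (process Y X₀ k) := by
  induction k with
  | zero => exact hX₀
  | succ k ih => exact ih.step (Y k)

/-- The *mountain* at `(l, r)`: the range equal to `r` in column `l` and to `r - |n - l| + 1` in
column `n ≠ l` ("flat tops of width 3, sides of gradient ±1"; Grimmett–Manolescu 2014, §6.2,
display following the definition of regular ranges). Heights live in `ℤ ∪ {-∞}` (`WithBot ℤ`), as the column heights `H^k_n` of a
path do; the mountain at height `-∞` is `-∞` everywhere. The *covering* `C(R)` of a range is the
pointwise maximum of the mountains of its elements; below, "`h ≤ C(R)_n`" is used in the form
"`h ≤ mountain l (R l) n` for some `l`". [cite: GrimmettManolescu2014Isoradial, §6.2 proof of Prop 6.4] -/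
def mountain (l : ℤ) (r : WithBot ℤ) (n : ℤ) : WithBot ℤ :=
  if n = l then r else r + (((1 : ℤ) - |n - l| : ℤ) : WithBot ℤ)

/-- Mountains are monotone in their height (so the covering `C` is monotone). [folklore] -/
theorem mountain_mono (l : ℤ) {r r' : WithBot ℤ} (h : r ≤ r') (n : ℤ) :
    mountain l r n ≤ mountain l r' n := by
  unfold mountain
  split_ifs
  · exact h
  · exact add_le_add_left h _

/-- **The growth process covers its own mountains** (Grimmett–Manolescu 2014, §6.2, first
display after the statement of Lemma 6.7's consequences: "each range `X^k` is regular and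
`X^{k+1} ≥ C(X^k)`"): for a regular range `X`, every mountain `M(l, X_l)` lies below `step Y X`,
whatever `Y`. [cite: GrimmettManolescu2014Isoradial, §6.2 proof of Prop 6.4] -/
theorem mountain_le_step {X : ℤ → ℤ} (hX : IsRegular X) (Y : ℤ → Bool) (l n : ℤ) :
    mountain l (X l : WithBot ℤ) n ≤ (GrowthProcess.step Y X n : WithBot ℤ) := by
  unfold mountain GrowthProcess.step
  split_ifs with h
  · subst h
    exact_mod_cast (le_add_of_nonneg_right (by positivity)).trans (le_max_right _ _)
  · rw [← WithBot.coe_add, WithBot.coe_le_coe]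
    rcases lt_or_gt_of_ne h with hlt | hgt
    · -- `n < l`: compare with the right neighbour `n + 1`
      have := hX.le_add_abs l (n + 1)
      rw [abs_of_nonneg (by omega)] at this
      rw [abs_of_neg (by omega)]
      have : X l + (1 - -(n - l)) ≤ X (n + 1) := by omega
      exact this.trans ((le_max_right _ _).trans (le_max_left _ _))
    · -- `l < n`: compare with the left neighbour `n - 1`
      have := hX.le_add_abs l (n - 1)
      rw [abs_of_nonpos (by omega)] at this
      rw [abs_of_pos (by omega)]
      have : X l + (1 - (n - l)) ≤ X (n - 1) := by omega
      exact this.trans ((le_max_left _ _).trans (le_max_left _ _))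

/-- **Comparison step** (Grimmett–Manolescu 2014, §6.2, proof of Prop 6.4: "We show first, by
induction, that `X^k ≥ H^k` for all `k`"): if column heights `H^k_n ∈ ℤ ∪ {-∞}` satisfy, for `k < K`, either `H^{k+1}_n ≤ M(l, H^k_l)_n`
for some `l` (i.e. `H^{k+1}_n ≤ C(H^k)_n`) or `H^{k+1}_n ≤ H^k_n + Y^k_n` — this is their
Lemma 6.6, `H^{k+1}_n ≤ max{C(H^k)_n, H^k_n + Y^k_n}` — and `H^0 ≤ X^0` with `X^0` regular, then
`H^k ≤ X^k` for all `k ≤ K`. [cite: GrimmettManolescu2014Isoradial, §6.2 proof of Prop 6.4] -/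
theorem le_process_of_forall_step {Y : ℕ → ℤ → Bool} {X₀ : ℤ → ℤ} (hX₀ : IsRegular X₀)
    {H : ℕ → ℤ → WithBot ℤ} (h0 : ∀ n, H 0 n ≤ X₀ n) {K : ℕ}
    (hstep : ∀ k < K, ∀ n, (∃ l, H (k + 1) n ≤ mountain l (H k l) n) ∨
      H (k + 1) n ≤ H k n + (((Y k n).toNat : ℤ) : WithBot ℤ)) :
    ∀ k ≤ K, ∀ n, H k n ≤ process Y X₀ k n := by
  intro k
  induction k with
  | zero => exact fun _ n => by simpa using h0 n
  | succ k ih =>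
    intro hk n
    have ih' := ih (by omega)
    rw [process_succ]
    rcases hstep k (by omega) n with ⟨l, hl⟩ | hl
    · exact hl.trans ((mountain_mono l (ih' l) n).trans
        (mountain_le_step (isRegular_process hX₀ Y k) (Y k) l n))
    · refine hl.trans ?_
      calc H k n + (((Y k n).toNat : ℤ) : WithBot ℤ)
          ≤ (process Y X₀ k n : WithBot ℤ) + (((Y k n).toNat : ℤ) : WithBot ℤ) :=
            add_le_add_left (ih' n) _
        _ = ((process Y X₀ k n + (Y k n).toNat : ℤ) : WithBot ℤ) := (WithBot.coe_add _ _).symm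
        _ ≤ (GrowthProcess.step (Y k) (process Y X₀ k) n : WithBot ℤ) := by
            exact_mod_cast le_max_right _ _

end GrowthProcess

end Literature.Probability.Percolation
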